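import Mathlib
import HarnessLib
import Summits.NavierStokesRegularity.NavierStokesRegularity.Theorems.ThreadingFluxHorizonTowerZonalUniqueness
import Summits.NavierStokesRegularity.NavierStokesRegularity.Theorems.ThreadingFluxHorizonTowerDipoleTowerParity

/-!
# Crux `PoloidalLiouville` (stmt-NavierStokesRegularity-1222, wall W1), crux idea «horizon-threading-tower» (ns-idea-15):
# NON-VACUITY / SHARPNESS companion — every COAXIALLY ZONAL finite tower passes order one

ARM A (ns-exp-scalarLiouville g6), offer O1 (2026-08-29T06:09Z).  The finite-tower theorems at order one (`TwoShellHorizonTowerZonality`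
p691920, `DipoleTowerHorizonZonality` p701741, eng-3's zonal-top descent) conclude «coaxially zonal».  This file proves the CONVERSE,
which makes them honest characterisations and exhibits the witness class of their hypotheses: if every shell `H_l`, `l ∈ K`, of a finite
scale-free tower is infinitesimally zonal about ONE common axis `a ≠ 0` (`⟪a × x, ∇H_l(x)⟫ ≡ 0`), then the tower is annihilated by the
order-one horizon law off the centre (`horizonL1_eq_zero_of_coaxial`; three-shell form `dipoleTower_horizonL1_eq_zero_of_coaxial` in the
binders of `DipoleTowerHorizonZonality`).  Proof: coaxial zonal shells Poisson-commute everywhere (`bracket_eq_zero_of_coaxial_zonal`,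
p695724), and `𝔏₁` of a finite tower is a weighted sum of the pair brackets (`horizonL1_finiteTower_antisym`, p693759).

HONEST LABEL: elementary companion (non-vacuity of a hypothesis class); `HorizonTowerZonality`, `PoloidalLiouville` (1222) and NS
regularity are OPEN / NOT proved; nothing here is an NS statement.  `--supports stmt-NavierStokesRegularity-1222 --as helper`.
-/

-- the summit and its single sub-problem share the name (CONVENTIONS §1)
set_option linter.dupNamespace false

noncomputable section

namespace Summit.NavierStokesRegularity.NavierStokesRegularity.Theorems.PoloidalLiouville.HorizonTower

open Set Function Filter Topology
open scoped RealInnerProductSpace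
open Literature.Analysis.FluidPDE
open Literature.Geometry.DiscreteGeometry (inner_fin3 norm_sq_fin3)

section CoaxialOrderOne

/-- ★ **Every coaxially zonal finite tower passes order one**: if all shells `H_l` (`l ∈ K`, `l ≥ 1`, smooth, homogeneous, harmonic) satisfy
`⟪a × x, ∇H_l(x)⟫ = 0` for one common `a ≠ 0`, then `𝔏₁[Σ_{l∈K} U_{H_l}] ≡ 0` off the centre. [folklore] -/
theorem horizonL1_eq_zero_of_coaxial (K : Finset ℕ) (H : ℕ → E3 → ℝ) (hK : ∀ l ∈ K, 1 ≤ l)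
    (hH : ∀ l ∈ K, ContDiff ℝ (⊤ : ℕ∞) (H l)) (hhom : ∀ l ∈ K, ∀ (c : ℝ) (y : E3), H l (c • y) = c ^ l * H l y)
    (hharm : ∀ l ∈ K, ∀ y, Laplacian.laplacian (H l) y = 0) {a : E3} (ha : a ≠ 0)
    (hz : ∀ l ∈ K, ∀ x : E3, ⟪cross a x, gradient (H l) x⟫ = 0) {x : E3} (hx : x ≠ 0) :
    horizonL1 (fun z => ∑ l ∈ K, horizonProfile l (H l) 0 z) 0 x = 0 := by
  rw [horizonL1_finiteTower_antisym K H hK hH hhom hharm hx]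
  have hg : ∀ l ∈ K, Continuous (gradient (H l)) := fun l hl =>
    (OrderTwo.contDiff_gradient (n := 0) ((hH l hl).of_le (by norm_cast))).continuous
  have hbr : ∀ j ∈ K, ∀ k ∈ K, ⟪x, cross (gradient (H j) x) (gradient (H k) x)⟫ = 0 := fun j hj k hk =>
    bracket_eq_zero_of_coaxial_zonal ha (hg j hj) (hg k hk) (hz j hj) (hz k hk) x
  rw [Finset.sum_eq_zero fun j hj => Finset.sum_eq_zero fun k hk => by rw [hbr j hj k hk, mul_zero]]
  ring

/-- ★ **Three-shell form, in the binders of `DipoleTowerHorizonZonality`**: a dipole tower `U_A + U_B + U_C` (`A ∈ 𝓗_1`, `B ∈ 𝓗_m`,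
`C ∈ 𝓗_n`, `2 ≤ m, n`, `m ≠ n`) whose shells are zonal about one common axis `a ≠ 0` passes order one — the hypothesis class of
`DipoleTowerHorizonZonality` is exactly the coaxially zonal towers (its conclusion), so that theorem is a characterisation. [folklore] -/
theorem dipoleTower_horizonL1_eq_zero_of_coaxial {m n : ℕ} {A B C : E3 → ℝ} (hm : 2 ≤ m) (hn : 2 ≤ n) (hmn : m ≠ n)
    (hA : ContDiff ℝ (⊤ : ℕ∞) A) (hhomA : ∀ (c : ℝ) (y : E3), A (c • y) = c ^ 1 * A y) (hharmA : ∀ y, Laplacian.laplacian A y = 0)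
    (hB : ContDiff ℝ (⊤ : ℕ∞) B) (hhomB : ∀ (c : ℝ) (y : E3), B (c • y) = c ^ m * B y) (hharmB : ∀ y, Laplacian.laplacian B y = 0)
    (hC : ContDiff ℝ (⊤ : ℕ∞) C) (hhomC : ∀ (c : ℝ) (y : E3), C (c • y) = c ^ n * C y) (hharmC : ∀ y, Laplacian.laplacian C y = 0)
    {a : E3} (ha : a ≠ 0) (hAz : ∀ x : E3, ⟪cross a x, gradient A x⟫ = 0) (hBz : ∀ x : E3, ⟪cross a x, gradient B x⟫ = 0)
    (hCz : ∀ x : E3, ⟪cross a x, gradient C x⟫ = 0) {x : E3} (hx : x ≠ 0) :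
    horizonL1 (fun z => horizonProfile 1 A 0 z + horizonProfile m B 0 z + horizonProfile n C 0 z) 0 x = 0 := by
  classical
  have hm1 : m ≠ 1 := by omega
  have hn1 : n ≠ 1 := by omega
  set H : ℕ → E3 → ℝ := fun l => if l = 1 then A else if l = m then B else C with hHdef
  have hH1 : H 1 = A := by simp [hHdef]
  have hHm : H m = B := by simp [hHdef, hm1]
  have hHn : H n = C := by simp [hHdef, hn1, Ne.symm hmn]
  have hmem : ∀ l ∈ ({1, m, n} : Finset ℕ), l = 1 ∨ l = m ∨ l = n := fun l hl => by
    simpa only [Finset.mem_insert, Finset.mem_singleton] using hl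
  have hK : ∀ l ∈ ({1, m, n} : Finset ℕ), 1 ≤ l := by
    intro l hl; rcases hmem l hl with h | h | h <;> omega
  have hHs : ∀ l ∈ ({1, m, n} : Finset ℕ), ContDiff ℝ (⊤ : ℕ∞) (H l) := by
    intro l hl
    rcases hmem l hl with h | h | h
    · rw [h, hH1]; exact hA
    · rw [h, hHm]; exact hB
    · rw [h, hHn]; exact hC
  have hHhom : ∀ l ∈ ({1, m, n} : Finset ℕ), ∀ (c : ℝ) (y : E3), H l (c • y) = c ^ l * H l y := by
    intro l hl
    rcases hmem l hl with h | h | h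
    · rw [h, hH1]; exact hhomA
    · rw [h, hHm]; exact hhomB
    · rw [h, hHn]; exact hhomC
  have hHharm : ∀ l ∈ ({1, m, n} : Finset ℕ), ∀ y, Laplacian.laplacian (H l) y = 0 := by
    intro l hl
    rcases hmem l hl with h | h | h
    · rw [h, hH1]; exact hharmA
    · rw [h, hHm]; exact hharmB
    · rw [h, hHn]; exact hharmC
  have hHz : ∀ l ∈ ({1, m, n} : Finset ℕ), ∀ x : E3, ⟪cross a x, gradient (H l) x⟫ = 0 := by
    intro l hl
    rcases hmem l hl with h | h | h
    · rw [h, hH1]; exact hAz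
    · rw [h, hHm]; exact hBz
    · rw [h, hHn]; exact hCz
  have h := horizonL1_eq_zero_of_coaxial ({1, m, n} : Finset ℕ) H hK hHs hHhom hHharm ha hHz hx
  rwa [hHdef, dipoleTower_sum_eq hm hn hmn] at h

end CoaxialOrderOne

end Summit.NavierStokesRegularity.NavierStokesRegularity.Theorems.PoloidalLiouville.HorizonTower

end
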